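import Literature.Geometry.Riemannian.MetricFlowPhiLipschitz
import Mathlib.Analysis.Convex.Deriv
import Mathlib.MeasureTheory.Function.JacobianOneDim
import Mathlib.MeasureTheory.Function.L2Space
import Mathlib.MeasureTheory.Integral.IntervalIntegral.Basic
import HarnessLib

/-!
# Bamler's profile `F = Φ' ∘ Φ⁻¹` on `(0, 1)` (Bamler 2020a, §4.3, proof of Prop. 4.2)

R. Bamler, *Entropy and heat kernel bounds on a Ricci flow background*, arXiv:2008.07093, §4.3:
in the proof of the sharp `L²`-bound for `∇K/K` (Prop. 4.2, case `p = 2`) the comparison profile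
is `F(a) := Φ'(Φ⁻¹(a))`, `a ∈ (0, 1)`, where `Φ` is the antiderivative of `(4π)^{-1/2} e^{-x²/4}`
(`MetricFlow.Phi`, `MetricFlowPhi.lean`) and `Φ⁻¹ : (0, 1) → ℝ` its inverse (`MetricFlow.PhiInv`,
`MetricFlowPhiInv.lean`; limits at the endpoints in `MetricFlowPhiLipschitz.lean`). This file proves
the calculus of `F` that the argument uses:

* `hasDerivAt_deriv_Phi_comp_PhiInv` — `F'(a) = (Φ''/Φ')(Φ⁻¹ a) = −Φ⁻¹(a)/2` (chain rule with
  `Φ'' = −(x/2) Φ'`);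
* `tendsto_deriv_Phi_atBot`, `tendsto_deriv_Phi_atTop` — `Φ'(x) → 0` as `x → ∓∞`; composed with
  `Φ⁻¹(a) → ∓∞` as `a → 0⁺, 1⁻` (`tendsto_PhiInv_nhdsGT_zero`, `tendsto_PhiInv_nhdsLT_one`):
  `tendsto_deriv_Phi_comp_PhiInv_nhdsGT_zero`, `…_nhdsLT_one` — `F(a) → 0` at both ends;
* `concaveOn_deriv_Phi_comp_PhiInv` — `F` is concave on `(0, 1)` (`F'` is antitone, `Φ⁻¹` being
  increasing); `0 < F ≤ (4π)^{-1/2}` is `deriv_Phi_pos`, `deriv_Phi_le`;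
* `setIntegral_Ioo_comp_PhiInv`, `integrableOn_Ioo_comp_PhiInv_iff` — the substitution
  `a = Φ(x)`: `∫_{(0,1)} g(Φ⁻¹ a) da = ∫_ℝ Φ'(x) g(x) dx`, i.e. the law of `Φ⁻¹` under Lebesgue
  measure on `(0, 1)` is the centred Gaussian of variance `2` (`integral_deriv_Phi_mul`);
* `integral_sq_PhiInv_div_two` — `∫₀¹ (Φ⁻¹(a)/2)² da = ¼ ∫ x² dN(0,2) = ½`, with the integrand
  interval integrable (`intervalIntegrable_sq_PhiInv_div_two`);
* `deriv_Phi_comp_PhiInv_props` — the conjunction of the above, in the form consumed downstream.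

Everything is proved; no definitions, no named facts. What is NOT here: the rearrangement
argument of Prop. 4.2 itself and any heat-kernel statement.

## References

* R. H. Bamler, *Entropy and heat kernel bounds on a Ricci flow background*, arXiv:2008.07093
  (2020), §4.1 (`Φ`, `Φ⁻¹`), §4.3 (proof of Prop. 4.2: `F = Φ' ∘ Φ⁻¹`). [Bamler2020Entropy]
* R. H. Bamler, *Compactness theory of the space of super Ricci flows*, Invent. Math. 233 (2023),
  §3, (3.1) (`Φ' = (4π)^{-1/2} e^{-x²/4}`). [Bamler2023]
-/

noncomputable section

open Set Filter MeasureTheory ProbabilityTheory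
open scoped Topology NNReal ENNReal

namespace Literature.Geometry.Riemannian

namespace MetricFlow

/-! ### `Φ'` and `Φ''` -/

/-- `Φ` has derivative `Φ'(x)` at `x` (`deriv` form of `hasDerivAt_Phi`).
[cite: Bamler2023, §3, (3.1)] -/
theorem hasDerivAt_Phi_deriv (x : ℝ) : HasDerivAt Phi (deriv Phi x) x :=
  (differentiable_Phi x).hasDerivAt

/-- `Φ'` is the density of the centred Gaussian of variance `2`. [cite: Bamler2023, §3, (3.1)] -/
theorem deriv_Phi_eq_gaussianPDFReal (x : ℝ) : deriv Phi x = gaussianPDFReal 0 2 x := by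
  rw [deriv_Phi, gaussianPDFReal_zero_two]

/-- **`(Φ')' = −(x/2) Φ'`** as a `HasDerivAt` statement (Bamler 2020a, proof of Thm. 4.1:
"`Φ''_t(x) = −(x/2t) Φ'_t`", `t = 1`). [cite: Bamler2020Entropy, §4.2] -/
theorem hasDerivAt_deriv_Phi (x : ℝ) : HasDerivAt (deriv Phi) (-(x / 2) * deriv Phi x) x := by
  have hd : DifferentiableAt ℝ (deriv Phi) x := by
    rw [deriv_Phi_eq]
    fun_prop
  rw [← deriv_deriv_Phi]
  exact hd.hasDerivAt

/-- `Φ'(x) → 0` along any filter along which `x² → +∞`. [cite: Bamler2020Entropy, §4.3] -/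
theorem tendsto_deriv_Phi_of_tendsto_sq {l : Filter ℝ} (h : Tendsto (fun x : ℝ ↦ x ^ 2) l atTop) :
    Tendsto (deriv Phi) l (𝓝 0) := by
  rw [deriv_Phi_eq]
  have h1 : Tendsto (fun x : ℝ ↦ -x ^ 2 / 4) l atBot := by
    have h3 := (tendsto_neg_atTop_atBot.comp h).atBot_div_const (by norm_num : (0 : ℝ) < 4)
    simpa [Function.comp_def] using h3
  simpa using (Real.tendsto_exp_atBot.comp h1).const_mul (Real.sqrt (4 * Real.pi))⁻¹

/-- `Φ'(x) → 0` as `x → −∞`. [cite: Bamler2020Entropy, §4.3] -/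
theorem tendsto_deriv_Phi_atBot : Tendsto (deriv Phi) atBot (𝓝 0) :=
  tendsto_deriv_Phi_of_tendsto_sq <| by
    have h : Tendsto (fun x : ℝ ↦ |x| ^ 2) atBot atTop :=
      (tendsto_pow_atTop two_ne_zero).comp tendsto_abs_atBot_atTop
    simpa only [sq_abs] using h

/-- `Φ'(x) → 0` as `x → +∞`. [cite: Bamler2020Entropy, §4.3] -/
theorem tendsto_deriv_Phi_atTop : Tendsto (deriv Phi) atTop (𝓝 0) :=
  tendsto_deriv_Phi_of_tendsto_sq (tendsto_pow_atTop two_ne_zero)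

/-- The range of `Φ` is exactly `(0, 1)`. [cite: Bamler2020Entropy, §4.1] -/
theorem range_Phi : range Phi = Ioo 0 1 := by
  ext c
  constructor
  · rintro ⟨x, rfl⟩
    exact ⟨Phi_pos x, Phi_lt_one x⟩
  · rintro ⟨h0, h1⟩
    exact exists_Phi_eq h0 h1

/-! ### The profile `F = Φ' ∘ Φ⁻¹` -/

/-- **`F'(a) = −Φ⁻¹(a)/2`** for `F = Φ' ∘ Φ⁻¹` on `(0, 1)` (chain rule: `(Φ''/Φ')(Φ⁻¹ a)` with
`Φ'' = −(x/2) Φ'`). [cite: Bamler2020Entropy, §4.3] -/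
theorem hasDerivAt_deriv_Phi_comp_PhiInv {a : ℝ} (ha : a ∈ Ioo (0 : ℝ) 1) :
    HasDerivAt (fun a ↦ deriv Phi (PhiInv a)) (-(PhiInv a / 2)) a := by
  obtain ⟨x, rfl⟩ := exists_Phi_eq ha.1 ha.2
  have h1 : HasDerivAt PhiInv (deriv Phi x)⁻¹ (Phi x) := by
    rw [deriv_Phi]
    exact hasDerivAt_PhiInv x
  have h2 : HasDerivAt (deriv Phi) (-(x / 2) * deriv Phi x) (PhiInv (Phi x)) := by
    rw [PhiInv_Phi]
    exact hasDerivAt_deriv_Phi x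
  rw [PhiInv_Phi]
  refine (h2.comp (Phi x) h1).congr_deriv ?_
  field_simp [(deriv_Phi_pos x).ne']

/-- **`F(a) → 0` as `a → 0⁺`.** [cite: Bamler2020Entropy, §4.3] -/
theorem tendsto_deriv_Phi_comp_PhiInv_nhdsGT_zero :
    Tendsto (fun a ↦ deriv Phi (PhiInv a)) (𝓝[>] 0) (𝓝 0) :=
  tendsto_deriv_Phi_atBot.comp tendsto_PhiInv_nhdsGT_zero

/-- **`F(a) → 0` as `a → 1⁻`.** [cite: Bamler2020Entropy, §4.3] -/
theorem tendsto_deriv_Phi_comp_PhiInv_nhdsLT_one :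
    Tendsto (fun a ↦ deriv Phi (PhiInv a)) (𝓝[<] 1) (𝓝 0) :=
  tendsto_deriv_Phi_atTop.comp tendsto_PhiInv_nhdsLT_one

/-- **`F = Φ' ∘ Φ⁻¹` is concave on `(0, 1)`**: its derivative `−Φ⁻¹/2` is antitone.
[cite: Bamler2020Entropy, §4.3] -/
theorem concaveOn_deriv_Phi_comp_PhiInv :
    ConcaveOn ℝ (Ioo (0 : ℝ) 1) (fun a ↦ deriv Phi (PhiInv a)) := by
  refine AntitoneOn.concaveOn_of_deriv (convex_Ioo 0 1)
    (fun a ha ↦ (hasDerivAt_deriv_Phi_comp_PhiInv ha).continuousAt.continuousWithinAt) ?_ ?_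
  · rw [interior_Ioo]
    exact fun a ha ↦ (hasDerivAt_deriv_Phi_comp_PhiInv ha).differentiableAt.differentiableWithinAt
  · rw [interior_Ioo]
    intro a ha b hb hab
    rw [(hasDerivAt_deriv_Phi_comp_PhiInv ha).deriv, (hasDerivAt_deriv_Phi_comp_PhiInv hb).deriv]
    have := PhiInv_strictMonoOn.monotoneOn ha hb hab
    linarith

/-! ### The substitution `a = Φ(x)` and `∫₀¹ (Φ⁻¹/2)² = 1/2` -/

/-- **Substitution `a = Φ(x)`**: `∫_{(0,1)} g(Φ⁻¹ a) da = ∫_ℝ Φ'(x) g(x) dx` for every `g` (both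
sides are junk simultaneously). [folklore] -/
theorem setIntegral_Ioo_comp_PhiInv (g : ℝ → ℝ) :
    ∫ a in Ioo (0 : ℝ) 1, g (PhiInv a) = ∫ x, deriv Phi x * g x := by
  have h := integral_image_eq_integral_abs_deriv_smul MeasurableSet.univ
    (fun x _ ↦ (hasDerivAt_Phi_deriv x).hasDerivWithinAt) Phi_strictMono.injective.injOn
    (fun a ↦ g (PhiInv a))
  rw [image_univ, range_Phi, Measure.restrict_univ] at h
  rw [h]
  refine integral_congr_ae (Eventually.of_forall fun x ↦ ?_)
  simp only [PhiInv_Phi, smul_eq_mul, abs_of_pos (deriv_Phi_pos x)]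

/-- Integrability in the substitution `a = Φ(x)`: `g ∘ Φ⁻¹` is integrable on `(0, 1)` iff
`Φ' · g` is integrable on `ℝ`. [folklore] -/
theorem integrableOn_Ioo_comp_PhiInv_iff (g : ℝ → ℝ) :
    IntegrableOn (fun a ↦ g (PhiInv a)) (Ioo (0 : ℝ) 1) ↔
      Integrable (fun x ↦ deriv Phi x * g x) := by
  have h := integrableOn_image_iff_integrableOn_abs_deriv_smul MeasurableSet.univ
    (fun x _ ↦ (hasDerivAt_Phi_deriv x).hasDerivWithinAt) Phi_strictMono.injective.injOn
    (fun a ↦ g (PhiInv a))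
  rw [image_univ, range_Phi, integrableOn_univ] at h
  rw [h]
  refine integrable_congr (Eventually.of_forall fun x ↦ ?_)
  simp only [PhiInv_Phi, smul_eq_mul, abs_of_pos (deriv_Phi_pos x)]

/-- `∫_ℝ Φ'(x) g(x) dx` is the expectation of `g` under the centred Gaussian of variance `2`.
[folklore] -/
theorem integral_deriv_Phi_mul (g : ℝ → ℝ) :
    ∫ x, deriv Phi x * g x = ∫ x, g x ∂(gaussianReal 0 2) := by
  rw [integral_gaussianReal_eq_integral_smul two_ne_zero]
  simp only [smul_eq_mul, deriv_Phi_eq_gaussianPDFReal]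

/-- `Φ' · g` is Lebesgue integrable iff `g` is integrable for the centred Gaussian of variance `2`.
[folklore] -/
theorem integrable_deriv_Phi_mul_iff (g : ℝ → ℝ) :
    Integrable (fun x ↦ deriv Phi x * g x) ↔ Integrable g (gaussianReal 0 2) := by
  rw [gaussianReal_of_var_ne_zero _ two_ne_zero,
    integrable_withDensity_iff_integrable_smul' (measurable_gaussianPDF 0 2)
      (Eventually.of_forall fun _ ↦ gaussianPDF_lt_top)]
  simp only [toReal_gaussianPDF, smul_eq_mul, deriv_Phi_eq_gaussianPDFReal]

/-- Second moment of the centred Gaussian of variance `2`: `∫ x² dN(0,2) = 2`. [folklore] -/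
theorem integral_sq_gaussianReal_zero_two : ∫ x, x ^ 2 ∂(gaussianReal 0 2) = 2 := by
  have h := variance_eq_integral (μ := gaussianReal 0 2) (X := id) measurable_id.aemeasurable
  rw [variance_id_gaussianReal] at h
  simp only [id_eq, integral_id_gaussianReal, sub_zero] at h
  rw [← h]
  norm_num

/-- `x²` is integrable for the centred Gaussian of variance `2`. [folklore] -/
theorem integrable_sq_gaussianReal_zero_two : Integrable (fun x : ℝ ↦ x ^ 2) (gaussianReal 0 2) :=
  (memLp_two_iff_integrable_sq aestronglyMeasurable_id).1
    (memLp_id_gaussianReal' 2 ENNReal.ofNat_ne_top)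

/-- **`(Φ⁻¹/2)²` is integrable on `(0, 1)`.** [cite: Bamler2020Entropy, §4.3] -/
theorem intervalIntegrable_sq_PhiInv_div_two :
    IntervalIntegrable (fun a ↦ (PhiInv a / 2) ^ 2) volume 0 1 := by
  rw [intervalIntegrable_iff_integrableOn_Ioo_of_le zero_le_one]
  refine (integrableOn_Ioo_comp_PhiInv_iff (fun x ↦ (x / 2) ^ 2)).2 ?_
  rw [integrable_deriv_Phi_mul_iff]
  refine (integrable_sq_gaussianReal_zero_two.div_const 4).congr (Eventually.of_forall fun x ↦ ?_)
  ring

/-- **`∫₀¹ (Φ⁻¹(a)/2)² da = 1/2`** (substituting `a = Φ(x)`: `¼ ∫_ℝ x² Φ'(x) dx = ¼ · 2`).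
[cite: Bamler2020Entropy, §4.3] -/
theorem integral_sq_PhiInv_div_two : ∫ a in (0 : ℝ)..1, (PhiInv a / 2) ^ 2 = 1 / 2 := by
  rw [intervalIntegral.integral_of_le zero_le_one, integral_Ioc_eq_integral_Ioo,
    setIntegral_Ioo_comp_PhiInv (fun x ↦ (x / 2) ^ 2), integral_deriv_Phi_mul]
  have h : ∫ x, (x / 2) ^ 2 ∂(gaussianReal 0 2) = (∫ x, x ^ 2 ∂(gaussianReal 0 2)) / 4 := by
    rw [← integral_div]
    refine integral_congr_ae (Eventually.of_forall fun x ↦ ?_)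
    ring
  rw [h, integral_sq_gaussianReal_zero_two]
  norm_num

/-- **Bamler's profile `F = Φ' ∘ Φ⁻¹` on `(0, 1)`** (2020a, §4.3, proof of Prop. 4.2):
`F' = −Φ⁻¹/2`; `F → 0` at `0⁺` and `1⁻`; `F` is concave; `0 < F ≤ (4π)^{-1/2}`; and
`∫₀¹ (Φ⁻¹/2)² = 1/2` with an integrable integrand. [cite: Bamler2020Entropy, §4.3] -/
theorem deriv_Phi_comp_PhiInv_props :
    (∀ a ∈ Ioo (0 : ℝ) 1, HasDerivAt (fun a ↦ deriv Phi (PhiInv a)) (-(PhiInv a / 2)) a) ∧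
    Tendsto (fun a ↦ deriv Phi (PhiInv a)) (𝓝[>] 0) (𝓝 0) ∧
    Tendsto (fun a ↦ deriv Phi (PhiInv a)) (𝓝[<] 1) (𝓝 0) ∧
    ConcaveOn ℝ (Ioo (0 : ℝ) 1) (fun a ↦ deriv Phi (PhiInv a)) ∧
    (∀ a ∈ Ioo (0 : ℝ) 1, 0 < deriv Phi (PhiInv a) ∧
      deriv Phi (PhiInv a) ≤ (Real.sqrt (4 * Real.pi))⁻¹) ∧
    IntervalIntegrable (fun a ↦ (PhiInv a / 2) ^ 2) volume 0 1 ∧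
    ∫ a in (0 : ℝ)..1, (PhiInv a / 2) ^ 2 = 1 / 2 :=
  ⟨fun _ ha ↦ hasDerivAt_deriv_Phi_comp_PhiInv ha, tendsto_deriv_Phi_comp_PhiInv_nhdsGT_zero,
    tendsto_deriv_Phi_comp_PhiInv_nhdsLT_one, concaveOn_deriv_Phi_comp_PhiInv,
    fun _ _ ↦ ⟨deriv_Phi_pos _, deriv_Phi_le _⟩, intervalIntegrable_sq_PhiInv_div_two,
    integral_sq_PhiInv_div_two⟩

end MetricFlow

end Literature.Geometry.Riemannian

end
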